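import Mathlib.NumberTheory.Chebyshev
import Mathlib.Analysis.SpecificLimits.Basic
import Mathlib.Analysis.Complex.ExponentialBounds
import Mathlib.Algebra.Order.Field.GeomSum
import Literature.NumberTheory.Sieve.PrimePairsSieveBound
import HarnessLib

/-!
# Tools for the off-diagonal terms of Montgomery's mean square: dyadic Chebyshev sums, prime pairs, `∑ 1/φ`

Trunk T-ANT (`Literature/NumberTheory/LFunctions`). Proofs only (no definitions, no named facts).
Elementary estimates consumed by `MontgomeryOffDiagonalSums.lean` (the arithmetic half of the mean
square `∫_0^T |∑ Λ(n) a_n(x) n^{-it}|² dt = T x log x + O(Tx) + O(x² log x)` of Montgomery's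
Dirichlet series, Goldston 2005, (4.6)):

* `Montgomery.sum_Ioc_mul_le_dyadic`, `Montgomery.sum_Ioc_mul_le_of_dyadic` — **dyadic summation**:
  if `f ≥ 0` has Chebyshev-type partial sums `∑_{n ≤ M} f(n) ≤ C M` and `g ≥ 0` is non-increasing
  on `[Y, ∞)`, then `∑_{Y < n ≤ M} f(n) g(n) ≤ 2C ∑_j 2^j Y g(2^j Y)`; specialised to `g(n) = 1/n²`
  (`≤ 4C/Y`, `Montgomery.sum_Ioc_div_sq_le_of_chebyshev`) and `g(n) = 1/(n√n)` (`≤ 8C/√Y`,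
  `Montgomery.sum_Ioc_div_mul_sqrt_le_of_chebyshev`);
* `Montgomery.sum_Icc_vonMangoldt_le` — Chebyshev's `ψ(M) ≤ (log 4 + 4) M` (Mathlib) for `Icc 1 M`;
* `Montgomery.exists_sum_Ioc_vonMangoldt_mul_shift_le` — **prime pairs with von Mangoldt weights**:
  `∑_{h < m ≤ M} Λ(m) Λ(m + h) ≤ C (h/φ(h)) M` for all `h ≥ 1` and all `M`, from the tree's PROVED
  upper-bound sieve for prime pairs `#{p ≤ N : p + h prime} ≪ (h/φ(h)) N/log² N`
  (`Sieve.Lichtman2020.primePairs_card_le`, `PrimePairsSieveBound.lean`) and `ψ − ϑ ≤ 2√x log x`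
  (Mathlib) for the higher prime powers;
* `Montgomery.sum_Icc_inv_totient_le` (`∑_{h ≤ M} 1/φ(h) ≤ 7 + 12 log M`) and
  `Montgomery.sum_Ioc_div_totient_div_sq_le` (`∑_{Y < h ≤ M} (h/φ(h))/h² ≤ 4e/Y`), from the tree's
  `∑_{h ≤ H} h/φ(h) ≤ eH` (`Sieve.Lichtman2020.sum_div_totient_le`) by dyadic summation.

## References

* H. L. Montgomery, R. C. Vaughan, *Multiplicative Number Theory I*, CUP 2007, §2.1 (Chebyshev),
  Cor. 3.14 (prime pairs), §2.3 exercises (`∑ 1/φ`). [folklore]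
* D. A. Goldston, *Notes on pair correlation of zeros and prime numbers*, LMS Lecture Note Ser. 322
  (2005), §4, (4.6).
-/

noncomputable section

open Finset Real
open ArithmeticFunction hiding log id
open scoped Chebyshev

namespace Literature.NumberTheory.LFunctions

namespace Montgomery

/-! ## Dyadic summation against Chebyshev-type partial sums -/

/-- **Dyadic summation**: if `f ≥ 0` with `∑_{n ≤ M} f(n) ≤ C M` for all `M`, and `g ≥ 0` is
non-increasing on `[Y, ∞)` (`Y ≥ 1`), then
`∑_{Y < n ≤ 2^J Y} f(n) g(n) ≤ 2C ∑_{j < J} 2^j Y g(2^j Y)` (on the block `(2^j Y, 2^{j+1} Y]`,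
`g ≤ g(2^j Y)` and `∑ f ≤ C 2^{j+1} Y`). [folklore] -/
theorem sum_Ioc_mul_le_dyadic {f g : ℕ → ℝ} {C : ℝ} {Y : ℕ}
    (hf : ∀ n, 0 ≤ f n) (hF : ∀ M : ℕ, ∑ n ∈ Finset.Icc 1 M, f n ≤ C * M)
    (hg0 : ∀ n, 0 ≤ g n) (hg : ∀ m n : ℕ, Y ≤ m → m ≤ n → g n ≤ g m) (J : ℕ) :
    ∑ n ∈ Finset.Ioc Y (2 ^ J * Y), f n * g n ≤
      2 * C * ∑ j ∈ Finset.range J, ((2 : ℝ) ^ j * Y) * g (2 ^ j * Y) := by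
  induction J with
  | zero => simp
  | succ J ih =>
    have h1 : Y ≤ 2 ^ J * Y := Nat.le_mul_of_pos_left Y (by positivity)
    have h2 : 2 ^ J * Y ≤ 2 ^ (J + 1) * Y :=
      Nat.mul_le_mul_right Y (Nat.pow_le_pow_right (by norm_num) (Nat.le_succ J))
    rw [← Finset.sum_Ioc_consecutive _ h1 h2, Finset.sum_range_succ, mul_add]
    refine add_le_add ih ?_
    have hblock : ∑ n ∈ Finset.Ioc (2 ^ J * Y) (2 ^ (J + 1) * Y), f n * g n ≤
        (∑ n ∈ Finset.Ioc (2 ^ J * Y) (2 ^ (J + 1) * Y), f n) * g (2 ^ J * Y) := by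
      rw [Finset.sum_mul]
      refine Finset.sum_le_sum fun n hn ↦ ?_
      rw [Finset.mem_Ioc] at hn
      exact mul_le_mul_of_nonneg_left (hg _ _ h1 hn.1.le) (hf n)
    have hsumf : ∑ n ∈ Finset.Ioc (2 ^ J * Y) (2 ^ (J + 1) * Y), f n ≤
        C * ((2 ^ (J + 1) * Y : ℕ) : ℝ) := by
      refine le_trans ?_ (hF _)
      refine Finset.sum_le_sum_of_subset_of_nonneg (fun n hn ↦ ?_) fun n _ _ ↦ hf n
      rw [Finset.mem_Ioc] at hn
      rw [Finset.mem_Icc]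
      exact ⟨Nat.succ_le_of_lt (lt_of_le_of_lt (Nat.zero_le _) hn.1), hn.2⟩
    calc ∑ n ∈ Finset.Ioc (2 ^ J * Y) (2 ^ (J + 1) * Y), f n * g n
        ≤ (∑ n ∈ Finset.Ioc (2 ^ J * Y) (2 ^ (J + 1) * Y), f n) * g (2 ^ J * Y) := hblock
      _ ≤ C * ((2 ^ (J + 1) * Y : ℕ) : ℝ) * g (2 ^ J * Y) :=
          mul_le_mul_of_nonneg_right hsumf (hg0 _)
      _ = 2 * C * ((2 : ℝ) ^ J * Y * g (2 ^ J * Y)) := by push_cast; ring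

/-- **Dyadic summation, bounded form**: under the hypotheses of `sum_Ioc_mul_le_dyadic`, if the
dyadic sums `∑_{j < J} 2^j Y g(2^j Y)` are `≤ B` for every `J`, then
`∑_{Y < n ≤ M} f(n) g(n) ≤ 2 C B` for every `M`. [folklore] -/
theorem sum_Ioc_mul_le_of_dyadic {f g : ℕ → ℝ} {C B : ℝ} {Y : ℕ} (hY : 1 ≤ Y)
    (hf : ∀ n, 0 ≤ f n) (hF : ∀ M : ℕ, ∑ n ∈ Finset.Icc 1 M, f n ≤ C * M)
    (hg0 : ∀ n, 0 ≤ g n) (hg : ∀ m n : ℕ, Y ≤ m → m ≤ n → g n ≤ g m)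
    (hB : ∀ J : ℕ, ∑ j ∈ Finset.range J, ((2 : ℝ) ^ j * Y) * g (2 ^ j * Y) ≤ B) (M : ℕ) :
    ∑ n ∈ Finset.Ioc Y M, f n * g n ≤ 2 * C * B := by
  have hC : 0 ≤ C := by
    have h := hF 1
    simp only [Finset.Icc_self, Finset.sum_singleton, Nat.cast_one, mul_one] at h
    exact (hf 1).trans h
  have hM : M ≤ 2 ^ M * Y := (M.lt_two_pow_self).le.trans (Nat.le_mul_of_pos_right _ hY)
  calc ∑ n ∈ Finset.Ioc Y M, f n * g n ≤ ∑ n ∈ Finset.Ioc Y (2 ^ M * Y), f n * g n :=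
        Finset.sum_le_sum_of_subset_of_nonneg (Finset.Ioc_subset_Ioc_right hM)
          fun n _ _ ↦ mul_nonneg (hf n) (hg0 n)
    _ ≤ 2 * C * ∑ j ∈ Finset.range M, ((2 : ℝ) ^ j * Y) * g (2 ^ j * Y) :=
        sum_Ioc_mul_le_dyadic hf hF hg0 hg M
    _ ≤ 2 * C * B := mul_le_mul_of_nonneg_left (hB M) (by positivity)

/-- **Tails with weight `1/n²`**: if `f ≥ 0` with `∑_{n ≤ M} f(n) ≤ C M` for all `M`, then for
`Y ≥ 1` and all `M`, `∑_{Y < n ≤ M} f(n)/n² ≤ 4C/Y`. [folklore] -/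
theorem sum_Ioc_div_sq_le_of_chebyshev {f : ℕ → ℝ} {C : ℝ} {Y : ℕ} (hY : 1 ≤ Y)
    (hf : ∀ n, 0 ≤ f n) (hF : ∀ M : ℕ, ∑ n ∈ Finset.Icc 1 M, f n ≤ C * M) (M : ℕ) :
    ∑ n ∈ Finset.Ioc Y M, f n / (n : ℝ) ^ 2 ≤ 4 * C / Y := by
  have hY0 : (0 : ℝ) < Y := by exact_mod_cast hY
  have hg : ∀ m n : ℕ, Y ≤ m → m ≤ n → 1 / (n : ℝ) ^ 2 ≤ 1 / (m : ℝ) ^ 2 := by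
    intro m n hm hmn
    have hm0 : (0 : ℝ) < m := by exact_mod_cast (lt_of_lt_of_le Nat.one_pos (hY.trans hm))
    apply one_div_le_one_div_of_le (by positivity)
    exact pow_le_pow_left₀ hm0.le (by exact_mod_cast hmn) 2
  have hB : ∀ J : ℕ, ∑ j ∈ Finset.range J,
      ((2 : ℝ) ^ j * Y) * (1 / (((2 ^ j * Y : ℕ) : ℝ)) ^ 2) ≤ 2 / (Y : ℝ) := by
    intro J
    have e : ∀ j : ℕ, ((2 : ℝ) ^ j * Y) * (1 / (((2 ^ j * Y : ℕ) : ℝ)) ^ 2) =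
        (1 / (Y : ℝ)) * (1 / 2 : ℝ) ^ j := by
      intro j
      have h2 : (2 : ℝ) ^ j ≠ 0 := by positivity
      have hY' : (Y : ℝ) ≠ 0 := hY0.ne'
      rw [one_div_pow]
      push_cast
      field_simp
    simp_rw [e, ← Finset.mul_sum]
    calc 1 / (Y : ℝ) * ∑ j ∈ Finset.range J, (1 / 2 : ℝ) ^ j ≤ 1 / (Y : ℝ) * 2 :=
          mul_le_mul_of_nonneg_left (sum_geometric_two_le J) (by positivity)
      _ = 2 / (Y : ℝ) := by ring
  have h := sum_Ioc_mul_le_of_dyadic (g := fun n ↦ 1 / (n : ℝ) ^ 2) hY hf hF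
    (fun n ↦ by positivity) hg hB M
  calc ∑ n ∈ Finset.Ioc Y M, f n / (n : ℝ) ^ 2 = ∑ n ∈ Finset.Ioc Y M, f n * (1 / (n : ℝ) ^ 2) :=
        Finset.sum_congr rfl fun n _ ↦ by ring
    _ ≤ 2 * C * (2 / (Y : ℝ)) := h
    _ = 4 * C / Y := by ring

/-- `(4/3)^j ≤ √(2^j)` (`16/9 ≤ 2`). [folklore] -/
theorem four_thirds_pow_le_sqrt_two_pow (j : ℕ) : (4 / 3 : ℝ) ^ j ≤ Real.sqrt ((2 : ℝ) ^ j) := by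
  rw [Real.le_sqrt (by positivity) (by positivity), ← pow_mul, mul_comm, pow_mul]
  exact pow_le_pow_left₀ (by positivity) (by norm_num) j

/-- **Tails with weight `n^{-3/2}`**: if `f ≥ 0` with `∑_{n ≤ M} f(n) ≤ C M` for all `M`, then
for `Y ≥ 1` and all `M`, `∑_{Y < n ≤ M} f(n)/(n√n) ≤ 8C/√Y`. [folklore] -/
theorem sum_Ioc_div_mul_sqrt_le_of_chebyshev {f : ℕ → ℝ} {C : ℝ} {Y : ℕ} (hY : 1 ≤ Y)
    (hf : ∀ n, 0 ≤ f n) (hF : ∀ M : ℕ, ∑ n ∈ Finset.Icc 1 M, f n ≤ C * M) (M : ℕ) :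
    ∑ n ∈ Finset.Ioc Y M, f n / ((n : ℝ) * Real.sqrt n) ≤ 8 * C / Real.sqrt Y := by
  have hY0 : (0 : ℝ) < Y := by exact_mod_cast hY
  have hsY : 0 < Real.sqrt Y := Real.sqrt_pos.2 hY0
  have hg : ∀ m n : ℕ, Y ≤ m → m ≤ n →
      1 / ((n : ℝ) * Real.sqrt n) ≤ 1 / ((m : ℝ) * Real.sqrt m) := by
    intro m n hm hmn
    have hm0 : (0 : ℝ) < m := by exact_mod_cast (lt_of_lt_of_le Nat.one_pos (hY.trans hm))
    have hmn' : (m : ℝ) ≤ n := by exact_mod_cast hmn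
    apply one_div_le_one_div_of_le (by positivity)
    exact mul_le_mul hmn' (Real.sqrt_le_sqrt hmn') (Real.sqrt_nonneg _) (by positivity)
  have hB : ∀ J : ℕ, ∑ j ∈ Finset.range J,
      ((2 : ℝ) ^ j * Y) * (1 / ((((2 ^ j * Y : ℕ) : ℝ)) * Real.sqrt (((2 ^ j * Y : ℕ) : ℝ)))) ≤
        4 / Real.sqrt Y := by
    intro J
    have e : ∀ j : ℕ, ((2 : ℝ) ^ j * Y) *
        (1 / ((((2 ^ j * Y : ℕ) : ℝ)) * Real.sqrt (((2 ^ j * Y : ℕ) : ℝ)))) ≤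
          (1 / Real.sqrt Y) * (3 / 4 : ℝ) ^ j := by
      intro j
      have h2 : (0 : ℝ) < 2 ^ j := by positivity
      have h43 : (0 : ℝ) < (4 / 3 : ℝ) ^ j := by positivity
      push_cast
      rw [Real.sqrt_mul (by positivity)]
      have hs2 : (4 / 3 : ℝ) ^ j ≤ Real.sqrt ((2 : ℝ) ^ j) := four_thirds_pow_le_sqrt_two_pow j
      have hs2pos : 0 < Real.sqrt ((2 : ℝ) ^ j) := lt_of_lt_of_le h43 hs2
      calc (2 : ℝ) ^ j * Y * (1 / ((2 : ℝ) ^ j * Y * (Real.sqrt ((2 : ℝ) ^ j) * Real.sqrt Y)))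
          = 1 / (Real.sqrt ((2 : ℝ) ^ j) * Real.sqrt Y) := by field_simp
        _ ≤ 1 / ((4 / 3 : ℝ) ^ j * Real.sqrt Y) :=
            one_div_le_one_div_of_le (by positivity) (mul_le_mul_of_nonneg_right hs2 hsY.le)
        _ = (1 / Real.sqrt Y) * (3 / 4 : ℝ) ^ j := by
            rw [show (3 / 4 : ℝ) ^ j = 1 / (4 / 3 : ℝ) ^ j by rw [one_div, ← inv_pow]; norm_num]
            field_simp
    refine (Finset.sum_le_sum fun j _ ↦ e j).trans ?_
    rw [← Finset.mul_sum]
    have hgeom : ∑ j ∈ Finset.range J, (3 / 4 : ℝ) ^ j ≤ 4 := by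
      have h := geom_sum_Ico_le_of_lt_one (x := (3 / 4 : ℝ)) (m := 0) (n := J)
        (by norm_num) (by norm_num)
      rw [← Finset.range_eq_Ico] at h
      refine h.trans ?_
      norm_num
    calc 1 / Real.sqrt Y * ∑ j ∈ Finset.range J, (3 / 4 : ℝ) ^ j ≤ 1 / Real.sqrt Y * 4 :=
          mul_le_mul_of_nonneg_left hgeom (by positivity)
      _ = 4 / Real.sqrt Y := by ring
  have h := sum_Ioc_mul_le_of_dyadic (g := fun n ↦ 1 / ((n : ℝ) * Real.sqrt n)) hY hf hF
    (fun n ↦ by positivity) hg hB M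
  calc ∑ n ∈ Finset.Ioc Y M, f n / ((n : ℝ) * Real.sqrt n)
      = ∑ n ∈ Finset.Ioc Y M, f n * (1 / ((n : ℝ) * Real.sqrt n)) :=
        Finset.sum_congr rfl fun n _ ↦ by ring
    _ ≤ 2 * C * (4 / Real.sqrt Y) := h
    _ = 8 * C / Real.sqrt Y := by ring

/-! ## Chebyshev's bound for `∑_{n ≤ M} Λ(n)` -/

/-- Chebyshev (Mathlib's `Chebyshev.psi_le_const_mul_self`): `∑_{1 ≤ n ≤ M} Λ(n) = ψ(M) ≤ (log 4 + 4) M`.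
[folklore] -/
theorem sum_Icc_vonMangoldt_le (M : ℕ) :
    ∑ n ∈ Finset.Icc 1 M, Λ n ≤ (Real.log 4 + 4) * M := by
  have h := Chebyshev.psi_le_const_mul_self (Nat.cast_nonneg M)
  rw [Chebyshev.psi, Nat.floor_natCast] at h
  have e : Finset.Icc 1 M = Finset.Ioc 0 M := by
    ext n; simp only [Finset.mem_Icc, Finset.mem_Ioc]; omega
  rw [e]
  exact h

/-- `∑_{1 ≤ n ≤ M, n not prime} Λ(n) = ψ(M) − ϑ(M) ≤ 2 √M log M`. [folklore] -/
theorem sum_Icc_vonMangoldt_not_prime_le (M : ℕ) :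
    ∑ n ∈ Finset.Icc 1 M, (if n.Prime then 0 else Λ n) ≤ 2 * Real.sqrt M * Real.log M := by
  rcases Nat.eq_zero_or_pos M with rfl | hM
  · simp
  have hM1 : (1 : ℝ) ≤ M := by exact_mod_cast hM
  have h := Chebyshev.psi_sub_theta_le hM1
  rw [Chebyshev.psi_sub_theta_eq_sum_not_prime, Nat.floor_natCast, Finset.sum_filter] at h
  have e : Finset.Icc 1 M = Finset.Ioc 0 M := by
    ext n; simp only [Finset.mem_Icc, Finset.mem_Ioc]; omega
  rw [e]
  refine le_trans (le_of_eq (Finset.sum_congr rfl fun n _ ↦ ?_)) h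
  by_cases hp : n.Prime <;> simp [hp]

/-! ## Prime pairs with von Mangoldt weights -/

/-- `log y ≤ 4 √(√y)` for `y ≥ 0` (`log y = 4 log y^{1/4} ≤ 4 (y^{1/4} − 1)`). [folklore] -/
theorem log_le_four_mul_sqrt_sqrt {y : ℝ} (hy : 0 ≤ y) :
    Real.log y ≤ 4 * Real.sqrt (Real.sqrt y) := by
  rcases hy.eq_or_lt with rfl | hy0
  · simp
  have h1 : Real.log (Real.sqrt (Real.sqrt y)) = Real.log y / 4 := by
    rw [Real.log_sqrt (Real.sqrt_nonneg _), Real.log_sqrt hy]; ring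
  have h2 : Real.log (Real.sqrt (Real.sqrt y)) ≤ Real.sqrt (Real.sqrt y) - 1 :=
    Real.log_le_sub_one_of_pos (Real.sqrt_pos.2 (Real.sqrt_pos.2 hy0))
  linarith

/-- `(log M)(log 2M) ≤ 16 √(2M)` for `M ≥ 1`. [folklore] -/
theorem log_mul_log_two_mul_le {M : ℝ} (hM : 1 ≤ M) :
    Real.log M * Real.log (2 * M) ≤ 16 * Real.sqrt (2 * M) := by
  have hM0 : 0 < M := by linarith
  have hl1 : Real.log M ≤ 4 * Real.sqrt (Real.sqrt M) := log_le_four_mul_sqrt_sqrt hM0.le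
  have hl2 : Real.log (2 * M) ≤ 4 * Real.sqrt (Real.sqrt (2 * M)) :=
    log_le_four_mul_sqrt_sqrt (by positivity)
  have hss : Real.sqrt (Real.sqrt M) ≤ Real.sqrt (Real.sqrt (2 * M)) :=
    Real.sqrt_le_sqrt (Real.sqrt_le_sqrt (by linarith))
  have hsq : Real.sqrt (Real.sqrt (2 * M)) * Real.sqrt (Real.sqrt (2 * M)) = Real.sqrt (2 * M) :=
    Real.mul_self_sqrt (Real.sqrt_nonneg (2 * M))
  calc Real.log M * Real.log (2 * M)
      ≤ (4 * Real.sqrt (Real.sqrt M)) * (4 * Real.sqrt (Real.sqrt (2 * M))) :=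
        mul_le_mul hl1 hl2 (Real.log_nonneg (by linarith)) (by positivity)
    _ ≤ (4 * Real.sqrt (Real.sqrt (2 * M))) * (4 * Real.sqrt (Real.sqrt (2 * M))) :=
        mul_le_mul_of_nonneg_right (by linarith) (by positivity)
    _ = 16 * (Real.sqrt (Real.sqrt (2 * M)) * Real.sqrt (Real.sqrt (2 * M))) := by ring
    _ = 16 * Real.sqrt (2 * M) := by rw [hsq]

/-- **Prime pairs with von Mangoldt weights**: there is an absolute `C ≥ 0` such that for all
`h ≥ 1` and all `M`, `∑_{h < m ≤ M} Λ(m) Λ(m + h) ≤ C (h/φ(h)) M`. The pairs of primes `(p, p+h)`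
are counted by the upper-bound sieve `#{p ≤ M : p + h prime} ≤ C₀ (h/φ(h)) M/log² M`
(`Sieve.Lichtman2020.primePairs_card_le`, from Montgomery–Vaughan, *Multiplicative Number Theory I*,
Cor. 3.14), each weighted by `≤ log M · log 2M ≤ 2 log² M`; the pairs involving a higher prime power
contribute `≤ log(2M) (ψ − ϑ)(2M) ≪ √M log² M ≤ 128 M`. [folklore] -/
theorem exists_sum_Ioc_vonMangoldt_mul_shift_le :
    ∃ C : ℝ, 0 ≤ C ∧ ∀ h : ℕ, 1 ≤ h → ∀ M : ℕ,
      ∑ m ∈ Finset.Ioc h M, Λ m * Λ (m + h) ≤ C * ((h : ℝ) / Nat.totient h) * M := by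
  obtain ⟨C₀, hC₀⟩ := Literature.NumberTheory.Sieve.primePairs_card_le
  refine ⟨2 * max C₀ 0 + 128, by positivity, fun h hh M ↦ ?_⟩
  have hφpos : (0 : ℝ) < Nat.totient h := by exact_mod_cast Nat.totient_pos.2 hh
  have hw1 : 1 ≤ (h : ℝ) / Nat.totient h := by
    rw [le_div_iff₀ hφpos, one_mul]; exact_mod_cast Nat.totient_le h
  rcases le_or_gt M h with hMh | hMh
  · rw [Finset.Ioc_eq_empty (not_lt.2 hMh), Finset.sum_empty]; positivity
  have hM2 : 2 ≤ M := by omega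
  have hM2r : (2 : ℝ) ≤ M := by exact_mod_cast hM2
  have hM0 : (0 : ℝ) < M := by linarith
  have hhM : (h : ℝ) < M := by exact_mod_cast hMh
  have hlogM : 0 < Real.log M := Real.log_pos (by linarith)
  have hlog2M : Real.log (2 * M) ≤ 2 * Real.log M := by
    have h2 : (2 : ℝ) * M ≤ M ^ 2 := by nlinarith
    calc Real.log (2 * M) ≤ Real.log (M ^ 2) := Real.log_le_log (by positivity) h2
      _ = 2 * Real.log M := by rw [Real.log_pow]; push_cast; ring
  have hlog2M0 : 0 ≤ Real.log (2 * M) := Real.log_nonneg (by linarith)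
  -- `Λ'` = `Λ` restricted to the non-primes (higher prime powers)
  set Λ' : ℕ → ℝ := fun n ↦ if n.Prime then 0 else Λ n with hΛ'
  have hΛ'0 : ∀ n, 0 ≤ Λ' n := by
    intro n; simp only [hΛ']; split_ifs
    · exact le_rfl
    · exact vonMangoldt_nonneg
  -- pointwise decomposition
  have hpt : ∀ m ∈ Finset.Ioc h M, Λ m * Λ (m + h) ≤
      Real.log M * Real.log (2 * M) * (if m.Prime ∧ (m + h).Prime then 1 else 0) +
        Real.log M * Λ' (m + h) + Real.log (2 * M) * Λ' m := by
    intro m hm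
    rw [Finset.mem_Ioc] at hm
    have hm0 : (0 : ℝ) < m := by exact_mod_cast (lt_of_le_of_lt (Nat.zero_le h) hm.1)
    have hmM : (m : ℝ) ≤ M := by exact_mod_cast hm.2
    have hmhM : ((m + h : ℕ) : ℝ) ≤ 2 * M := by
      have : (h : ℝ) < m := by exact_mod_cast hm.1
      push_cast; linarith
    have hΛm : Λ m ≤ Real.log M := vonMangoldt_le_log.trans (Real.log_le_log hm0 hmM)
    have hΛmh : Λ (m + h) ≤ Real.log (2 * M) :=
      vonMangoldt_le_log.trans (Real.log_le_log (by positivity) hmhM)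
    have hΛm0 : 0 ≤ Λ m := vonMangoldt_nonneg
    have hΛmh0 : 0 ≤ Λ (m + h) := vonMangoldt_nonneg
    by_cases hp : m.Prime
    · by_cases hq : (m + h).Prime
      · have e1 : (if m.Prime ∧ (m + h).Prime then (1 : ℝ) else 0) = 1 := by simp [hp, hq]
        rw [e1, mul_one]
        have h0 : 0 ≤ Real.log M * Λ' (m + h) + Real.log (2 * M) * Λ' m :=
          add_nonneg (mul_nonneg hlogM.le (hΛ'0 _)) (mul_nonneg hlog2M0 (hΛ'0 _))
        have := mul_le_mul hΛm hΛmh hΛmh0 hlogM.le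
        linarith
      · have e1 : (if m.Prime ∧ (m + h).Prime then (1 : ℝ) else 0) = 0 := by simp [hq]
        have e2 : Λ' (m + h) = Λ (m + h) := by simp only [hΛ', hq, if_false]
        rw [e1, e2, mul_zero, zero_add]
        have h0 : 0 ≤ Real.log (2 * M) * Λ' m := mul_nonneg hlog2M0 (hΛ'0 _)
        have := mul_le_mul_of_nonneg_right hΛm hΛmh0
        linarith
    · have e1 : (if m.Prime ∧ (m + h).Prime then (1 : ℝ) else 0) = 0 := by simp [hp]
      have e2 : Λ' m = Λ m := by simp only [hΛ', hp, if_false]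
      rw [e1, e2, mul_zero, zero_add]
      have h0 : 0 ≤ Real.log M * Λ' (m + h) := mul_nonneg hlogM.le (hΛ'0 _)
      have : Λ m * Λ (m + h) ≤ Real.log (2 * M) * Λ m := by
        rw [mul_comm]; exact mul_le_mul_of_nonneg_right hΛmh hΛm0
      linarith
  -- (i) the prime pairs
  have h1 : ∑ m ∈ Finset.Ioc h M, (if m.Prime ∧ (m + h).Prime then (1 : ℝ) else 0) ≤
      max C₀ 0 * ((h : ℝ) / Nat.totient h) * ((M : ℝ) / Real.log M ^ 2) := by
    rw [Finset.sum_boole]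
    have hsub : (Finset.Ioc h M).filter (fun m ↦ m.Prime ∧ (m + h).Prime) ⊆
        (Nat.primesLE M).filter (fun p ↦ (p + h).Prime) := by
      intro m hm'
      simp only [Finset.mem_filter, Finset.mem_Ioc, Nat.mem_primesLE] at hm' ⊢
      exact ⟨⟨hm'.1.2, hm'.2.1⟩, hm'.2.2⟩
    calc ((#((Finset.Ioc h M).filter (fun m ↦ m.Prime ∧ (m + h).Prime)) : ℕ) : ℝ)
        ≤ (#((Nat.primesLE M).filter (fun p ↦ (p + h).Prime)) : ℝ) := by
          exact_mod_cast Finset.card_le_card hsub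
      _ ≤ C₀ * (((h : ℝ) / Nat.totient h) * ((M : ℝ) / Real.log M ^ 2)) := hC₀ M h hh hMh.le hM2
      _ ≤ max C₀ 0 * (((h : ℝ) / Nat.totient h) * ((M : ℝ) / Real.log M ^ 2)) :=
          mul_le_mul_of_nonneg_right (le_max_left _ _) (by positivity)
      _ = max C₀ 0 * ((h : ℝ) / Nat.totient h) * ((M : ℝ) / Real.log M ^ 2) := by ring
  -- (ii) higher prime powers at `m`
  have h2 : ∑ m ∈ Finset.Ioc h M, Λ' m ≤ 2 * Real.sqrt M * Real.log M := by
    calc ∑ m ∈ Finset.Ioc h M, Λ' m ≤ ∑ m ∈ Finset.Icc 1 M, Λ' m := by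
          refine Finset.sum_le_sum_of_subset_of_nonneg (fun m hm ↦ ?_) fun _ _ _ ↦ hΛ'0 _
          rw [Finset.mem_Ioc] at hm
          rw [Finset.mem_Icc]; omega
      _ ≤ 2 * Real.sqrt M * Real.log M := sum_Icc_vonMangoldt_not_prime_le M
  -- (iii) higher prime powers at `m + h`
  have h3 : ∑ m ∈ Finset.Ioc h M, Λ' (m + h) ≤ 2 * Real.sqrt (2 * M) * Real.log (2 * M) := by
    have e : ∑ m ∈ Finset.Ioc h M, Λ' (m + h) = ∑ n ∈ Finset.Ioc (h + h) (M + h), Λ' n := by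
      rw [← Finset.map_add_right_Ioc, Finset.sum_map]; rfl
    rw [e]
    have hle : ((M + h : ℕ) : ℝ) ≤ 2 * M := by push_cast; linarith
    have hge : (1 : ℝ) ≤ ((M + h : ℕ) : ℝ) := by exact_mod_cast (show 1 ≤ M + h by omega)
    calc ∑ n ∈ Finset.Ioc (h + h) (M + h), Λ' n ≤ ∑ n ∈ Finset.Icc 1 (M + h), Λ' n := by
          refine Finset.sum_le_sum_of_subset_of_nonneg (fun m hm ↦ ?_) fun _ _ _ ↦ hΛ'0 _
          rw [Finset.mem_Ioc] at hm
          rw [Finset.mem_Icc]; omega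
      _ ≤ 2 * Real.sqrt ((M + h : ℕ) : ℝ) * Real.log ((M + h : ℕ) : ℝ) :=
          sum_Icc_vonMangoldt_not_prime_le (M + h)
      _ ≤ 2 * Real.sqrt (2 * M) * Real.log (2 * M) :=
          mul_le_mul (mul_le_mul_of_nonneg_left (Real.sqrt_le_sqrt hle) two_pos.le)
            (Real.log_le_log (by linarith) hle) (Real.log_nonneg hge) (by positivity)
  -- combine
  have hsum := Finset.sum_le_sum hpt
  rw [Finset.sum_add_distrib, Finset.sum_add_distrib, ← Finset.mul_sum, ← Finset.mul_sum,
    ← Finset.mul_sum] at hsum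
  have hll : Real.log M * Real.log (2 * M) ≤ 16 * Real.sqrt (2 * M) :=
    log_mul_log_two_mul_le (by linarith)
  have hsqM : Real.sqrt M ≤ Real.sqrt (2 * M) := Real.sqrt_le_sqrt (by linarith)
  have hs2 : Real.sqrt (2 * M) * Real.sqrt (2 * M) = 2 * M := Real.mul_self_sqrt (by positivity)
  have hw0 : 0 ≤ (h : ℝ) / Nat.totient h := by positivity
  -- the main term
  have hmain : Real.log M * Real.log (2 * M) *
      (max C₀ 0 * ((h : ℝ) / Nat.totient h) * ((M : ℝ) / Real.log M ^ 2)) ≤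
        2 * max C₀ 0 * ((h : ℝ) / Nat.totient h) * M := by
    have e : Real.log M * Real.log (2 * M) *
        (max C₀ 0 * ((h : ℝ) / Nat.totient h) * ((M : ℝ) / Real.log M ^ 2)) =
          (Real.log (2 * M) / Real.log M) * (max C₀ 0 * ((h : ℝ) / Nat.totient h) * M) := by
      field_simp
    rw [e]
    have hq : Real.log (2 * M) / Real.log M ≤ 2 := by rw [div_le_iff₀ hlogM]; linarith
    have h0 : 0 ≤ max C₀ 0 * ((h : ℝ) / Nat.totient h) * M := by positivity
    nlinarith
  -- the two error terms
  have herr1 : Real.log M * (2 * Real.sqrt (2 * M) * Real.log (2 * M)) ≤ 64 * M := by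
    nlinarith [Real.sqrt_nonneg (2 * M)]
  have herr2 : Real.log (2 * M) * (2 * Real.sqrt M * Real.log M) ≤ 64 * M := by
    have : Real.log (2 * M) * (2 * Real.sqrt M * Real.log M) ≤
        Real.log (2 * M) * (2 * Real.sqrt (2 * M) * Real.log M) := by
      gcongr
    nlinarith [Real.sqrt_nonneg (2 * M)]
  have hM' : (M : ℝ) ≤ ((h : ℝ) / Nat.totient h) * M := le_mul_of_one_le_left hM0.le hw1
  calc ∑ m ∈ Finset.Ioc h M, Λ m * Λ (m + h)
      ≤ Real.log M * Real.log (2 * M) *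
            ∑ m ∈ Finset.Ioc h M, (if m.Prime ∧ (m + h).Prime then (1 : ℝ) else 0) +
          Real.log M * ∑ m ∈ Finset.Ioc h M, Λ' (m + h) +
          Real.log (2 * M) * ∑ m ∈ Finset.Ioc h M, Λ' m := hsum
    _ ≤ Real.log M * Real.log (2 * M) *
            (max C₀ 0 * ((h : ℝ) / Nat.totient h) * ((M : ℝ) / Real.log M ^ 2)) +
          Real.log M * (2 * Real.sqrt (2 * M) * Real.log (2 * M)) +
          Real.log (2 * M) * (2 * Real.sqrt M * Real.log M) := by
        gcongr
    _ ≤ 2 * max C₀ 0 * ((h : ℝ) / Nat.totient h) * M + 64 * M + 64 * M := by linarith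
    _ ≤ (2 * max C₀ 0 + 128) * ((h : ℝ) / Nat.totient h) * M := by nlinarith [le_max_right C₀ 0]

/-! ## Reciprocal sums of Euler's function -/

/-- `∑_{1 ≤ h ≤ M} 1/φ(h) ≤ 7 + 12 log M`, from `∑_{h ≤ H} h/φ(h) ≤ eH`
(`Sieve.Lichtman2020.sum_div_totient_le`) by dyadic summation with the weight `1/h`
(`⌊log₂ M⌋ + 1 ≤ 2 log M + 1` blocks, each contributing `≤ 2e`). [folklore] -/
theorem sum_Icc_inv_totient_le (M : ℕ) :
    ∑ h ∈ Finset.Icc 1 M, 1 / (Nat.totient h : ℝ) ≤ 7 + 12 * Real.log M := by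
  rcases Nat.eq_zero_or_pos M with rfl | hM
  · simp
  have hM0 : (0 : ℝ) < M := by exact_mod_cast hM
  have hlogM : 0 ≤ Real.log M := Real.log_nonneg (by exact_mod_cast hM)
  rw [Finset.Icc_eq_cons_Ioc hM, Finset.sum_cons]
  simp only [Nat.totient_one, Nat.cast_one, div_one]
  set J : ℕ := Nat.log 2 M + 1 with hJ
  have hMJ : M ≤ 2 ^ J * 1 := by
    rw [mul_one]; exact (Nat.lt_pow_succ_log_self one_lt_two M).le
  have hf : ∀ n : ℕ, 0 ≤ (n : ℝ) / Nat.totient n := fun n ↦ by positivity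
  have hF : ∀ M' : ℕ, ∑ n ∈ Finset.Icc 1 M', (n : ℝ) / Nat.totient n ≤ Real.exp 1 * M' :=
    fun M' ↦ Literature.NumberTheory.Sieve.Lichtman2020.sum_div_totient_le M'
  have hg0 : ∀ n : ℕ, 0 ≤ 1 / (n : ℝ) := fun n ↦ by positivity
  have hg : ∀ m n : ℕ, 1 ≤ m → m ≤ n → 1 / (n : ℝ) ≤ 1 / (m : ℝ) := fun m n hm hmn ↦
    one_div_le_one_div_of_le (by exact_mod_cast hm) (by exact_mod_cast hmn)
  have hd := sum_Ioc_mul_le_dyadic (f := fun n : ℕ ↦ (n : ℝ) / Nat.totient n)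
    (g := fun n : ℕ ↦ 1 / (n : ℝ)) hf hF hg0 hg J
  have hds : ∑ j ∈ Finset.range J, ((2 : ℝ) ^ j * ((1 : ℕ) : ℝ)) * (1 / (((2 ^ j * 1 : ℕ) : ℝ))) = J := by
    have e : ∀ j ∈ Finset.range J,
        ((2 : ℝ) ^ j * ((1 : ℕ) : ℝ)) * (1 / (((2 ^ j * 1 : ℕ) : ℝ))) = 1 := by
      intro j _
      have h2 : (0 : ℝ) < 2 ^ j := by positivity
      push_cast
      field_simp
    rw [Finset.sum_congr rfl e, Finset.sum_const, Finset.card_range, nsmul_eq_mul, mul_one]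
  rw [hds] at hd
  have e : ∀ n ∈ Finset.Ioc 1 M, 1 / (Nat.totient n : ℝ) = (n : ℝ) / Nat.totient n * (1 / (n : ℝ)) := by
    intro n hn
    rw [Finset.mem_Ioc] at hn
    have hn0 : (n : ℝ) ≠ 0 := by exact_mod_cast (show n ≠ 0 by omega)
    have hφ0 : (Nat.totient n : ℝ) ≠ 0 := by exact_mod_cast (Nat.totient_pos.2 (by omega)).ne'
    field_simp
  rw [Finset.sum_congr rfl e]
  -- `J ≤ 2 log M + 1`
  have hJle : (J : ℝ) ≤ 2 * Real.log M + 1 := by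
    have hpow : ((2 : ℕ) : ℝ) ^ Nat.log 2 M ≤ M := by
      exact_mod_cast Nat.pow_log_le_self 2 hM.ne'
    have hl : (Nat.log 2 M : ℝ) * Real.log 2 ≤ Real.log M := by
      have := Real.log_le_log (by positivity) hpow
      rwa [Real.log_pow] at this
    have hl2 : (0.6931471803 : ℝ) < Real.log 2 := Real.log_two_gt_d9
    have hk0 : (0 : ℝ) ≤ Nat.log 2 M := Nat.cast_nonneg _
    have : (Nat.log 2 M : ℝ) ≤ 2 * Real.log M := by nlinarith
    simp only [hJ]; push_cast; linarith
  have he : Real.exp 1 < 2.7182818286 := Real.exp_one_lt_d9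
  have he0 : 0 < Real.exp 1 := Real.exp_pos 1
  calc 1 + ∑ n ∈ Finset.Ioc (1 : ℕ) M, (n : ℝ) / Nat.totient n * (1 / (n : ℝ))
      ≤ 1 + ∑ n ∈ Finset.Ioc (1 : ℕ) (2 ^ J * 1), (n : ℝ) / Nat.totient n * (1 / (n : ℝ)) := by
        have hsub : ∑ n ∈ Finset.Ioc (1 : ℕ) M, (n : ℝ) / Nat.totient n * (1 / (n : ℝ)) ≤
            ∑ n ∈ Finset.Ioc (1 : ℕ) (2 ^ J * 1), (n : ℝ) / Nat.totient n * (1 / (n : ℝ)) :=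
          Finset.sum_le_sum_of_subset_of_nonneg (Finset.Ioc_subset_Ioc_right hMJ)
            fun n _ _ ↦ mul_nonneg (hf n) (hg0 n)
        linarith
    _ ≤ 1 + 2 * Real.exp 1 * J := by linarith
    _ ≤ 1 + 2 * Real.exp 1 * (2 * Real.log M + 1) := by gcongr
    _ ≤ 7 + 12 * Real.log M := by nlinarith

/-- `∑_{Y < h ≤ M} (h/φ(h))/h² ≤ 4e/Y` for `Y ≥ 1` (dyadic summation of `∑_{h ≤ H} h/φ(h) ≤ eH`).
[folklore] -/
theorem sum_Ioc_div_totient_div_sq_le {Y : ℕ} (hY : 1 ≤ Y) (M : ℕ) :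
    ∑ h ∈ Finset.Ioc Y M, ((h : ℝ) / Nat.totient h) / (h : ℝ) ^ 2 ≤ 4 * Real.exp 1 / Y :=
  sum_Ioc_div_sq_le_of_chebyshev hY (fun n ↦ by positivity)
    (fun M' ↦ Literature.NumberTheory.Sieve.Lichtman2020.sum_div_totient_le M') M

end Montgomery

end Literature.NumberTheory.LFunctions
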